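import Summits.QuantumFields.BalabanUV.T4Continuum.Support.RegularSiteTransporters
import Summits.QuantumFields.BalabanUV.T4Continuum.Support.ScalarCovariantLaplacianLaws

/-!
# T⁴ programme, spine node NE2 (U1a), tier B — ROW B5 FEED: row B4.e's site-transport hypothesis structure `SiteTransportLaws0` (leaf-01)
# INSTANTIATED for the DETERMINED site transporters `siteT Rg`, from the regularity class and node NE3 BY NAME

NE2 formalisation swarm, leaf prover 03 (row B5 of `t4/formal/NE2/LEAVES.md`).  `Support/ScalarCovariantLaplacianLaws.perturbationLaws_scalarLayer`
(leaf-01, row B4.e END) and leaf-08's ROOT-B file `Spine/NE2BalabanFinal` display the binder `hT : SiteTransportLaws0 L M T τ τ′` on free site-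
transport DATA `T`.  For `T := siteT L M Rg` (this seat's `Support/RegularSiteTransporters`: the transport along the (1.7) legs, determined by
the bond transporters `Rg`) that binder is a THEOREM of `hreg : RegularTransporters L M (fun k => liftR (fine (lev L k) M) (Rg k)) α β` (row B5)
and `hNE3 : LocalRate (bgReadings L M (regClass L M (fun k => liftR … (Rg k)))) C L⁻¹` (node NE3 BY NAME; nothing of NE3 proved):
**`siteTransportLaws0_of_regular : SiteTransportLaws0 L M (siteT L M Rg) (e^{(d+1)α} − 1) (theta0 d α βNE3)`**, `βNE3 = 2·card o·C`,
`theta0` = leaf-06's closed form (row B3.b-conc (ii) file 3).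

HONEST FRAMING (T4-DAG p. 1).  Bookkeeping at MODEL LEVEL (`Rg` DATA; no claim that it is Bałaban's minimiser; (3.19) a SHAPE locator; no B0,
c5); CONDITIONAL on node NE3 (displayed, c2/c7); finite torus, operator norm; constants OURS; NOT [B9] (3.23)–(3.26) as printed; **NE2 NOT
PROVED**; NOT infinite volume, NOT a mass gap, NOT Clay, NOT summit progress; spine 0/9 unchanged.  HONEST DEPENDENCY: continuum YM on T⁴ ⇐
BetaPertH ∧ nine spine estimates (0/9 proved); BetaPertH ⇐ (D1) ∧ (D4) ∧ CAP+tail; G-an2-4 gates asym, D1 and NE2/3/4.  ABSOLUTE RULE kept;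
no `sorry`.
-/

noncomputable section

open scoped BigOperators ComplexConjugate Matrix Matrix.Norms.L2Operator Kronecker

namespace Summit.QuantumFields.BalabanUV.T4Continuum.RegularSiteTransportLaws

open Literature.MathematicalPhysics.QuantumFieldTheory.Balaban1983to89.B5Prop11Plancherel (Tor fine)
open Literature.MathematicalPhysics.QuantumFieldTheory.Balaban1983to89.B5G183RateUnitTower (lev lev_neZero)
open Literature.MathematicalPhysics.QuantumFieldTheory.Balaban1983to89.T4EtaRateMin (LocalRate)
open Summit.QuantumFields.BalabanUV.T4Continuum
open Summit.QuantumFields.BalabanUV.T4Continuum.BalabanAveragedTowerUnit (idx one_le_lev' cast_lev')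
open Summit.QuantumFields.BalabanUV.T4Continuum.NE2FromNE3 (bgReadings)
open Summit.QuantumFields.BalabanUV.T4Continuum.RegularBackgroundTower (RegularTransporters regClass betaNE3)
open Summit.QuantumFields.BalabanUV.T4Continuum.RegularSiteTransporters (siteT norm_siteT_sub_one_le norm_siteT_succ_sub_par_le_geom
  theta0_nonneg_of_regular)
open Summit.QuantumFields.BalabanUV.T4Continuum.NestedContourTransport (theta0)
open Summit.QuantumFields.BalabanUV.T4Continuum.GaugeTermDecomposition (liftR)
open Summit.QuantumFields.BalabanUV.T4Continuum.ScalarCovariantLaplacianLaws (SiteTransportLaws0)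

variable {d : ℕ} (L : ℕ) [NeZero L] (M : Fin d → ℕ) [hM : ∀ μ, NeZero (M μ)] {o : Type*} [Fintype o] [DecidableEq o]
variable {Rg : (k : ℕ) → Fin d → (Tor (fine (lev L k) M) → Matrix o o ℂ)} {α β : ℝ}

/-- **ROW B4.e's SITE-TRANSPORT STRUCTURE FOR THE DETERMINED SITE TRANSPORTERS, FROM `(hreg, hNE3)`** (`d ≥ 1`):
`SiteTransportLaws0 L M (siteT L M Rg) (e^{(d+1)α} − 1) (theta0 d α βNE3)`.  Binders displayed; NE2 is NOT proved by this. [folklore] -/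
theorem siteTransportLaws0_of_regular (hd : 1 ≤ d) (hreg : RegularTransporters L M (fun k => liftR (fine (lev L k) M) (Rg k)) α β)
    {C : ℝ} (hC : 0 ≤ C) (hNE3 : LocalRate (bgReadings L M (regClass L M (fun k => liftR (fine (lev L k) M) (Rg k)))) C ((L : ℝ)⁻¹)) :
    SiteTransportLaws0 L M (siteT L M Rg) (Real.exp ((d + 1 : ℕ) * α) - 1) (theta0 d α (betaNE3 o C)) where
  nonneg := ⟨sub_nonneg.mpr (Real.one_le_exp (mul_nonneg (Nat.cast_nonneg _) hreg.nonneg.1)), theta0_nonneg_of_regular hd hreg hC hNE3⟩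
  sub_one_le := fun k x => norm_siteT_sub_one_le hd hreg k x
  consistent := fun k x' => norm_siteT_succ_sub_par_le_geom hd hreg hC hNE3 k x'

end Summit.QuantumFields.BalabanUV.T4Continuum.RegularSiteTransportLaws

end
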